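import Mathlib
import HarnessLib

/-!
# Zhang (2022), §4, Lemmas 4.6–4.7 (proof): the Rouché comparison function `1 − P^{−2w}` —
# its polar displays, (4.13) on the circles `|w| = α(1 ∓ c′α𝓛)`, its zeros and their simplicity,
# and the sharpness `6 < 2π` of (4.13), kernel-checked

Topic `Literature/NumberTheory/LFunctions/Zhang2022` (Landau–Siegel autopsy tree; verdict-neutral).
Y. Zhang, *Discrete mean estimates and the Landau–Siegel zero*, arXiv:2211.02515v1 (2022) — **an
unrefereed manuscript, a claimed result under adjudication** (cell pub-zhang: audit + repair census
of arXiv:2211.02515; no claim about Landau–Siegel) — §4 p. 9, proof of Lemma 4.6 (and Lemma 4.7):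

> It suffices to show that the function `𝒜(1/2+iγ+w,ψ)` has exactly one zero inside the circle
> `|w| = α(1−c′α𝓛)`, counted with multiplicity. By the Rouché theorem, this can be reduced to proving
> that `|𝒜(1/2+iγ+w,ψ) − (1−P^{−2w})| < |1−P^{−2w}|` for `|w| = α(1−c′α𝓛)`, since the function
> `1 − P^{−2w}` has exactly one zero inside this circle which is at `w = 0`. In fact, we can prove that
> `𝒜(1/2+iγ+w,ψ) − (1−P^{−2w}) ≪ α𝓛` (4.12) if `|w| < 2α`, the implied constant being independent of
> `c′`, and `|1 − P^{−2w}| > 6c′α𝓛` (4.13) if `|w| = α(1−c′α𝓛)`. […]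
> Now assume `|w| = α(1−c′α𝓛)`. Write `w = α(1−c′α𝓛)(cos θ + i sin θ)`. Then
> `|P^{−2w}| = exp{−2π(1−c′α𝓛)cos θ}`, `Im{P^{−2w}} = −|P^{−2w}| sin{2π(1−c′α𝓛) sin θ}`;
> if `cos θ > c′α𝓛`, then `|P^{−2w}| < 1 − 6c′α𝓛`; if `cos θ < −c′α𝓛`, then `|P^{−2w}| > 1 + 6c′α𝓛`;
> if `|cos θ| ≤ c′α𝓛`, then `|Im{P^{−2w}}| > 6c′α𝓛`, since `√(1−(c′α𝓛)²) ≤ |sin θ| ≤ 1`, so that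
> `|sin{2π(1−c′α𝓛) sin θ}| = 2πc′α𝓛(1+o(1))`. In either case (4.16) [sic; (4.13)] holds. □
> Lemma 4.7. […] the function `𝒜(ρ+w,ψ)` has exactly three zeros inside the circle
> `|w| = α(1+c′α𝓛)`, counted with multiplicity. Proof. In a way similar to the proof of Lemma 4.6, it
> is direct to verify that `|𝒜(ρ+w,ψ) − (1−P^{−2w})| < |1−P^{−2w}|` if `|w| = α(1+c′α𝓛)`. Hence,
> the functions `𝒜(ρ+w,ψ)` and `1−P^{−2w}` have the same number of zeros inside this circle, while
> the later has exactly three zeros inside the same circle which are at `w = 0`, `w = iα` and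
> `w = −iα`. □

Here `α = π/log P` (2.10), so that `P^{−2w} = exp(−2w log P) = exp(−2πu)` with `w = αu`; the small
parameter `δ := c′α𝓛 = c′π𝓛/log P = c′π𝓛^{−8}` tends to `0` (`P = exp{𝓛⁹}` (2.6), `𝓛 = log D`).
Everything printed about the COMPARISON FUNCTION `1 − P^{−2w}` is an elementary statement about
`exp`, and this file PROVES it with the manuscript's constant `6` and an explicit range
`0 < δ ≤ 1/200` in place of "`δ = c′α𝓛`, `D` large" (namespace `Lemma46`, `Pw P w := exp(−2w log P)`,
`alpha P := π/log P`, any real `P > 1`):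

* `Lemma46.Pw_eq_cpow` — `Pw P w = P^{−2w}` (Mathlib `cpow`), and `Lemma46.Pw_alpha_mul` —
  `P^{−2αu} = e^{−2πu}`;
* `Lemma46.norm_Pw_polar`, `Lemma46.im_Pw_polar` — the two polar displays EXACT, for any radius:
  `w = αr(cos θ + i sin θ)` ⇒ `|P^{−2w}| = exp{−2πr cos θ}`, `Im{P^{−2w}} = −|P^{−2w}| sin{2πr sin θ}`;
* `Lemma46.norm_Pw_lt_of_cos_gt`, `Lemma46.norm_Pw_gt_of_cos_lt`, `Lemma46.abs_im_Pw_gt_of_abs_cos_le`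
  — the three case displays on `|w| = α(1−δ)`, `0 < δ ≤ 1/200`, with the printed constant `6`; and
  `Lemma46.abs_sin_le_and_le` — "`√(1−δ²) ≤ |sin θ| ≤ 1`" when `|cos θ| ≤ δ`;
* `Lemma46.ineq413` — **(4.13)**: `|1 − P^{−2w}| > 6δ` for `|w| = α(1−δ)`, `0 < δ ≤ 1/200`; and
  `Lemma46.ineq413_outer` — Lemma 4.7's "similar" twin on `|w| = α(1+δ)`;
* `Lemma46.Pw_eq_one_iff` — the zeros of `1 − P^{−2w}` are exactly `w = ikα`, `k ∈ ℤ`;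
  `Lemma46.zeros_inner_disc` — inside `|w| < α(1−δ)` (`0 ≤ δ < 1`) the zero set is `{0}`;
  `Lemma46.zeros_outer_disc` — inside `|w| < α(1+δ)` (`0 < δ ≤ 1`) it is `{0, iα, −iα}`;
  `Lemma46.hasDerivAt_one_sub_Pw`, `Lemma46.deriv_one_sub_Pw_ne_zero` — every zero is SIMPLE
  (`d/dw (1 − P^{−2w}) = 2(log P)P^{−2w} ≠ 0`), i.e. "counted with multiplicity" the counts are 1 and 3;
* `Lemma46.norm_one_sub_Pw_I_mul` — at the top of the circle, `w = iα(1−δ)`: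
  `|1 − P^{−2w}| = 2|sin(πδ)|` EXACT; hence `Lemma46.lt_two_pi_of_ineq413` — **the constant in (4.13)
  cannot reach `2π`**: if `|1 − P^{−2w}| > cδ` on the whole circle `|w| = α(1−δ)` for one
  `δ ∈ (0,1]`, then `c < 2π` (the cell's design row I-4.13a "`c_R < 2π`" as a theorem about the
  printed comparison function; the printed `6` satisfies it, `Lemma46.six_lt_two_pi`).

Also: `Lemma46.hasDerivAt_Pw`; the sine factors `Lemma46.abs_sin_inner_gt` / `abs_sin_outer_gt`
(`|sin{2π(1∓δ) sin θ}| > 2π(δ−δ²−δ³) − (2πδ)³/6` when `|cos θ| ≤ δ` — the manuscript's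
"`= 2πδ(1+o(1))`" made effective); the outer-circle case lemmas `…_outer`;
`Lemma46.one_sub_Pw_ne_zero_of_norm_eq` (no zero ON either circle). The range `δ ≤ 1/200` is where
the three printed case inequalities hold with the constant `6` (they need `6 < 2π e^{−2πδ}(1 − O(δ))`;
numerically the third case fails from `δ ≈ 0.007` on); the manuscript's `δ = c′α𝓛 → 0`.

What is NOT asserted: Rouché's theorem / the argument principle itself (not available in Mathlib in
the needed form), the estimate (4.12) (it rests on (4.10)–(4.11), i.e. on Lemmas 4.1–4.4), or anything
about `𝒜(s,ψ)`; so the conclusions of Lemmas 4.6–4.7 about the zeros of `L(s,ψ)L(s,ψχ)` are not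
stated here. Nothing about Theorems 1–2 of the source is stated or implied; nothing here bears on
the cell's verdict on (8.24).

## References

* Y. Zhang, arXiv:2211.02515v1 (2022), §4 p. 9, Lemma 4.6 (proof: (4.12), (4.13) and the five
  displays after "Now assume"), Lemma 4.7 (proof); (2.10) `α = π/log P`.
  [cite: Zhang2022LandauSiegel, §4 Lemma 4.6 (proof), (4.13)]
-/

noncomputable section

open Complex Real Set

namespace Literature.NumberTheory.LFunctions.Zhang2022

namespace Lemma46

/-! ### The comparison function `P^{−2w}` and the spacing `α = π/log P` -/

/-- `α = π / log P`, the mean spacing unit of (2.10). [cite: Zhang2022LandauSiegel, §2 (2.10)] -/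
def alpha (P : ℝ) : ℝ := Real.pi / Real.log P

/-- `P^{−2w}`, written as the entire function `exp(−2w log P)`.
[cite: Zhang2022LandauSiegel, §4 Lemma 4.6 (proof)] -/
def Pw (P : ℝ) (w : ℂ) : ℂ := Complex.exp (-(2 * w * (Real.log P : ℂ)))

/-- Unfolding lemma. [cite: Zhang2022LandauSiegel, §4 Lemma 4.6 (proof)] -/
lemma Pw_def (P : ℝ) (w : ℂ) : Pw P w = Complex.exp (-(2 * w * (Real.log P : ℂ))) := rfl

/-- Unfolding lemma. [cite: Zhang2022LandauSiegel, §2 (2.10)] -/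
lemma alpha_def (P : ℝ) : alpha P = Real.pi / Real.log P := rfl

/-- For `P > 1`, `α = π/log P > 0`. [cite: Zhang2022LandauSiegel, §2 (2.10)] -/
lemma alpha_pos {P : ℝ} (hP : 1 < P) : 0 < alpha P :=
  div_pos Real.pi_pos (Real.log_pos hP)

/-- `Pw P w` is Mathlib's complex power `P^{−2w}` (`P > 0`).
[cite: Zhang2022LandauSiegel, §4 Lemma 4.6 (proof)] -/
theorem Pw_eq_cpow {P : ℝ} (hP : 0 < P) (w : ℂ) : Pw P w = (P : ℂ) ^ (-(2 * w)) := by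
  have hP0 : (P : ℂ) ≠ 0 := Complex.ofReal_ne_zero.mpr hP.ne'
  rw [Pw_def, Complex.cpow_def_of_ne_zero hP0, (Complex.ofReal_log hP.le).symm]
  congr 1
  ring

/-- `P^{−2w}` never vanishes. [cite: Zhang2022LandauSiegel, §4 Lemma 4.6 (proof)] -/
lemma Pw_ne_zero (P : ℝ) (w : ℂ) : Pw P w ≠ 0 := Complex.exp_ne_zero _

/-- In the unit `α`: `P^{−2αu} = e^{−2πu}` (`P > 1`). [cite: Zhang2022LandauSiegel, §4 Lemma 4.6 (proof)] -/
theorem Pw_alpha_mul {P : ℝ} (hP : 1 < P) (u : ℂ) :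
    Pw P ((alpha P : ℂ) * u) = Complex.exp (-(2 * Real.pi * u)) := by
  have hlog : (Real.log P : ℂ) ≠ 0 := Complex.ofReal_ne_zero.mpr (Real.log_pos hP).ne'
  rw [Pw_def, alpha_def]
  congr 1
  push_cast
  field_simp

/-- The derivative `d/dw P^{−2w} = −2(log P)·P^{−2w}`. [cite: Zhang2022LandauSiegel, §4 Lemma 4.6 (proof)] -/
theorem hasDerivAt_Pw (P : ℝ) (w : ℂ) :
    HasDerivAt (Pw P) (-(2 * (Real.log P : ℂ)) * Pw P w) w := by
  have hfun : Pw P = fun z => Complex.exp (-(2 * (Real.log P : ℂ)) * z) := by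
    funext z
    rw [Pw_def]
    congr 1
    ring
  have h1 : HasDerivAt (fun z : ℂ => -(2 * (Real.log P : ℂ)) * z) (-(2 * (Real.log P : ℂ))) w := by
    simpa using (hasDerivAt_id w).const_mul (-(2 * (Real.log P : ℂ)))
  have h2 : HasDerivAt (Pw P)
      (Complex.exp (-(2 * (Real.log P : ℂ)) * w) * -(2 * (Real.log P : ℂ))) w := by
    rw [hfun]
    exact h1.cexp
  have hw : Complex.exp (-(2 * (Real.log P : ℂ)) * w) = Pw P w := by
    rw [hfun]
  rw [hw] at h2
  convert h2 using 1
  ring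

/-! ### The two polar displays (any radius `r`) -/

/-- `−2πr(cos θ + i sin θ) = (−2πr cos θ) + (−2πr sin θ)i` as real casts. [folklore] -/
private lemma expr_eq (r θ : ℝ) :
    -(2 * (Real.pi : ℂ) * ((r : ℂ) * ((Real.cos θ : ℂ) + (Real.sin θ : ℂ) * I)))
      = ((-(2 * Real.pi * r * Real.cos θ) : ℝ) : ℂ)
        + ((-(2 * Real.pi * r * Real.sin θ) : ℝ) : ℂ) * I := by
  push_cast
  ring

/-- Real part of `−2πr(cos θ + i sin θ)`. [folklore] -/
private lemma re_aux (r θ : ℝ) :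
    (-(2 * (Real.pi : ℂ) * ((r : ℂ) * ((Real.cos θ : ℂ) + (Real.sin θ : ℂ) * I)))).re
      = -(2 * Real.pi * r * Real.cos θ) := by
  rw [expr_eq, Complex.add_re, Complex.ofReal_re, Complex.mul_re, Complex.ofReal_re,
    Complex.ofReal_im, Complex.I_re, Complex.I_im]
  ring

/-- Imaginary part of `−2πr(cos θ + i sin θ)`. [folklore] -/
private lemma im_aux (r θ : ℝ) :
    (-(2 * (Real.pi : ℂ) * ((r : ℂ) * ((Real.cos θ : ℂ) + (Real.sin θ : ℂ) * I)))).im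
      = -(2 * Real.pi * r * Real.sin θ) := by
  rw [expr_eq, Complex.add_im, Complex.ofReal_im, Complex.mul_im, Complex.ofReal_re,
    Complex.ofReal_im, Complex.I_re, Complex.I_im]
  ring

/-- **"`|P^{−2w}| = exp{−2π(1−c′α𝓛)cos θ}`"** for `w = α(1−c′α𝓛)(cos θ + i sin θ)`, EXACT and for any
radius `r` in place of `1 − c′α𝓛`. [cite: Zhang2022LandauSiegel, §4 Lemma 4.6 (proof)] -/
theorem norm_Pw_polar {P : ℝ} (hP : 1 < P) (r θ : ℝ) :
    ‖Pw P ((alpha P : ℂ) * ((r : ℂ) * ((Real.cos θ : ℂ) + (Real.sin θ : ℂ) * I)))‖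
      = Real.exp (-(2 * Real.pi * r * Real.cos θ)) := by
  rw [Pw_alpha_mul hP, Complex.norm_exp, re_aux]

/-- **"`Im{P^{−2w}} = −|P^{−2w}| sin{2π(1−c′α𝓛) sin θ}`"** for `w = α(1−c′α𝓛)(cos θ + i sin θ)`, EXACT
and for any radius `r`. [cite: Zhang2022LandauSiegel, §4 Lemma 4.6 (proof)] -/
theorem im_Pw_polar {P : ℝ} (hP : 1 < P) (r θ : ℝ) :
    (Pw P ((alpha P : ℂ) * ((r : ℂ) * ((Real.cos θ : ℂ) + (Real.sin θ : ℂ) * I)))).im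
      = -(‖Pw P ((alpha P : ℂ) * ((r : ℂ) * ((Real.cos θ : ℂ) + (Real.sin θ : ℂ) * I)))‖
          * Real.sin (2 * Real.pi * r * Real.sin θ)) := by
  rw [norm_Pw_polar hP, Pw_alpha_mul hP, Complex.exp_im, re_aux, im_aux, Real.sin_neg]
  ring

/-! ### Numerical lemmas for `0 < δ ≤ 1/200` (where the printed constant `6 < 2π` is used) -/

/-- `2πδ ≤ 0.03142` for `δ ≤ 1/200`. [folklore] -/
private lemma two_pi_delta_le {δ : ℝ} (hδ0 : 0 < δ) (hδ1 : δ ≤ 1 / 200) :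
    2 * Real.pi * δ ≤ 0.03142 := by
  have hπ := Real.pi_lt_d4
  have h : 2 * Real.pi * δ ≤ 2 * Real.pi * (1 / 200) :=
    mul_le_mul_of_nonneg_left hδ1 (by positivity)
  linarith

/-- `exp(−2π(1−δ)δ) < 1 − 6δ` for `0 < δ ≤ 1/200`. [folklore] -/
private lemma exp_neg_lt_one_sub {δ : ℝ} (hδ0 : 0 < δ) (hδ1 : δ ≤ 1 / 200) :
    Real.exp (-(2 * Real.pi * (1 - δ) * δ)) < 1 - 6 * δ := by
  set b : ℝ := 2 * Real.pi * (1 - δ) * δ with hb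
  have hπl := Real.pi_gt_d4
  have hπu := Real.pi_lt_d4
  have hc : (6.2515 : ℝ) ≤ 2 * Real.pi * (1 - δ) := by nlinarith
  have hb1 : 6.2515 * δ ≤ b := by
    rw [hb]
    exact mul_le_mul_of_nonneg_right hc hδ0.le
  have hb0 : 0 < b := by linarith
  have hb2 : b ≤ 0.03142 := by
    rw [hb]
    have h1 : 2 * Real.pi * (1 - δ) * δ ≤ 2 * Real.pi * δ := by nlinarith [Real.pi_pos]
    linarith [two_pi_delta_le hδ0 hδ1]
  -- `exp(−b) ≤ 1/(1+b) < 1 − 6δ`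
  have hexp : Real.exp (-b) ≤ 1 / (1 + b) := by
    rw [Real.exp_neg, one_div]
    exact inv_anti₀ (by linarith) (by linarith [Real.add_one_le_exp b])
  have hkey : 1 / (1 + b) < 1 - 6 * δ := by
    rw [div_lt_iff₀ (by linarith)]
    have : 6 * δ * b ≤ 6 * δ * 0.03142 := by nlinarith
    nlinarith
  exact hexp.trans_lt hkey

/-- `1 + 6δ < exp(2π(1−δ)δ)` for `0 < δ ≤ 1/200`. [folklore] -/
private lemma one_add_lt_exp {δ : ℝ} (hδ0 : 0 < δ) (hδ1 : δ ≤ 1 / 200) :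
    1 + 6 * δ < Real.exp (2 * Real.pi * (1 - δ) * δ) := by
  have hπl := Real.pi_gt_d4
  have hc : (6 : ℝ) < 2 * Real.pi * (1 - δ) := by nlinarith
  have h1 : 1 + 6 * δ < 2 * Real.pi * (1 - δ) * δ + 1 := by
    nlinarith [mul_lt_mul_of_pos_right hc hδ0]
  exact h1.trans_le (Real.add_one_le_exp _)

/-- `A(δ) = 1 − 2π(1+δ)δ ≥ 0.9684` for `0 < δ ≤ 1/200`. [folklore] -/
private lemma A_ge {δ : ℝ} (hδ0 : 0 < δ) (hδ1 : δ ≤ 1 / 200) :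
    0.9684 ≤ 1 - 2 * Real.pi * (1 + δ) * δ := by
  have hπu := Real.pi_lt_d4
  have h1 : 2 * Real.pi * (1 + δ) ≤ 6.3147 := by nlinarith
  have h2 : 2 * Real.pi * (1 + δ) * δ ≤ 6.3147 * (1 / 200) :=
    mul_le_mul h1 hδ1 hδ0.le (by norm_num)
  linarith

/-- `B(δ) = 2π(1 − δ − δ²) − (2π)³δ²/6 ≥ 6.2503` for `0 < δ ≤ 1/200`. [folklore] -/
private lemma B_ge {δ : ℝ} (hδ0 : 0 < δ) (hδ1 : δ ≤ 1 / 200) :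
    6.2503 ≤ 2 * Real.pi * (1 - δ - δ ^ 2) - (2 * Real.pi) ^ 3 * δ ^ 2 / 6 := by
  have hπl := Real.pi_gt_d4
  have hπu := Real.pi_lt_d4
  have hδsq : δ ^ 2 ≤ 0.000025 := by nlinarith
  have h1 : 0.994975 ≤ 1 - δ - δ ^ 2 := by nlinarith
  have hπ2 : (6.283 : ℝ) ≤ 2 * Real.pi := by linarith
  have h2 : 6.283 * 0.994975 ≤ 2 * Real.pi * (1 - δ - δ ^ 2) :=
    mul_le_mul hπ2 h1 (by norm_num) (by positivity)
  have h3' : (2 * Real.pi) ^ 3 ≤ (6.2832 : ℝ) ^ 3 :=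
    pow_le_pow_left₀ (by positivity) (by linarith) 3
  have h3 : (2 * Real.pi) ^ 3 ≤ 249 := by
    have : (6.2832 : ℝ) ^ 3 ≤ 249 := by norm_num
    linarith
  have h4 : (2 * Real.pi) ^ 3 * δ ^ 2 / 6 ≤ 0.00104 := by
    have : (2 * Real.pi) ^ 3 * δ ^ 2 ≤ 249 * 0.000025 :=
      mul_le_mul h3 hδsq (sq_nonneg _) (by norm_num)
    linarith
  linarith

/-- Factoring `δ` out of the sine lower bound. [folklore] -/
private lemma B_factor (δ : ℝ) :
    2 * Real.pi * (δ - δ ^ 2 - δ ^ 3) - (2 * Real.pi * δ) ^ 3 / 6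
      = δ * (2 * Real.pi * (1 - δ - δ ^ 2) - (2 * Real.pi) ^ 3 * δ ^ 2 / 6) := by
  ring

/-- The main numerical inequality behind the third case:
`6δ < (1 − 2π(1+δ)δ)·(2π(δ − δ² − δ³) − (2πδ)³/6)` for `0 < δ ≤ 1/200` (`6.2503 × 0.9684 > 6`). [folklore] -/
private lemma six_delta_lt {δ : ℝ} (hδ0 : 0 < δ) (hδ1 : δ ≤ 1 / 200) :
    6 * δ < (1 - 2 * Real.pi * (1 + δ) * δ) *
      (2 * Real.pi * (δ - δ ^ 2 - δ ^ 3) - (2 * Real.pi * δ) ^ 3 / 6) := by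
  have hA := A_ge hδ0 hδ1
  have hB := B_ge hδ0 hδ1
  rw [B_factor]
  have hprod : 6.2503 * 0.9684 ≤ (2 * Real.pi * (1 - δ - δ ^ 2) - (2 * Real.pi) ^ 3 * δ ^ 2 / 6)
      * (1 - 2 * Real.pi * (1 + δ) * δ) :=
    mul_le_mul hB hA (by norm_num) (by linarith)
  have h6 : 6 * δ < δ * (6.2503 * 0.9684) := by nlinarith
  calc 6 * δ < δ * (6.2503 * 0.9684) := h6
    _ ≤ δ * ((2 * Real.pi * (1 - δ - δ ^ 2) - (2 * Real.pi) ^ 3 * δ ^ 2 / 6)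
          * (1 - 2 * Real.pi * (1 + δ) * δ)) := mul_le_mul_of_nonneg_left hprod hδ0.le
    _ = (1 - 2 * Real.pi * (1 + δ) * δ) *
          (δ * (2 * Real.pi * (1 - δ - δ ^ 2) - (2 * Real.pi) ^ 3 * δ ^ 2 / 6)) := by ring

/-- `A(δ) > 0`. [folklore] -/
private lemma A_pos {δ : ℝ} (hδ0 : 0 < δ) (hδ1 : δ ≤ 1 / 200) :
    0 < 1 - 2 * Real.pi * (1 + δ) * δ := by
  linarith [A_ge hδ0 hδ1]

/-- `δ·B(δ) > 0`. [folklore] -/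
private lemma Bδ_pos {δ : ℝ} (hδ0 : 0 < δ) (hδ1 : δ ≤ 1 / 200) :
    0 < 2 * Real.pi * (δ - δ ^ 2 - δ ^ 3) - (2 * Real.pi * δ) ^ 3 / 6 := by
  rw [B_factor]
  exact mul_pos hδ0 (by linarith [B_ge hδ0 hδ1])

/-! ### "`√(1−δ²) ≤ |sin θ| ≤ 1`" and the sine factor -/

/-- **"since `√(1−(c′α𝓛)²) ≤ |sin θ| ≤ 1`"** when `|cos θ| ≤ c′α𝓛`.
[cite: Zhang2022LandauSiegel, §4 Lemma 4.6 (proof)] -/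
theorem abs_sin_le_and_le {δ θ : ℝ} (h : |Real.cos θ| ≤ δ) :
    Real.sqrt (1 - δ ^ 2) ≤ |Real.sin θ| ∧ |Real.sin θ| ≤ 1 := by
  refine ⟨?_, Real.abs_sin_le_one θ⟩
  obtain ⟨h1, h2⟩ := abs_le.mp h
  have hcos2 : Real.cos θ ^ 2 ≤ δ ^ 2 := sq_le_sq' h1 h2
  have hsin2 : 1 - δ ^ 2 ≤ |Real.sin θ| ^ 2 := by
    rw [sq_abs]
    nlinarith [Real.sin_sq_add_cos_sq θ]
  calc Real.sqrt (1 - δ ^ 2) ≤ Real.sqrt (|Real.sin θ| ^ 2) := Real.sqrt_le_sqrt hsin2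
    _ = |Real.sin θ| := Real.sqrt_sq (abs_nonneg _)

/-- From `|cos θ| ≤ δ ≤ 1`: `1 − δ² ≤ |sin θ|` (the square-root-free form used below). [folklore] -/
private lemma one_sub_sq_le_abs_sin {δ θ : ℝ} (h : |Real.cos θ| ≤ δ) (hδ1 : δ ≤ 1) :
    1 - δ ^ 2 ≤ |Real.sin θ| := by
  obtain ⟨h1, h2⟩ := abs_le.mp h
  have hcos2 : Real.cos θ ^ 2 ≤ δ ^ 2 := sq_le_sq' h1 h2
  have h0 : 0 ≤ 1 - δ ^ 2 := by nlinarith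
  have h3 : 1 - δ ^ 2 ≤ 1 := by nlinarith
  have hsin2 : (1 - δ ^ 2) ^ 2 ≤ |Real.sin θ| ^ 2 := by
    rw [sq_abs]
    have h4 : 1 - δ ^ 2 ≤ Real.sin θ ^ 2 := by nlinarith [Real.sin_sq_add_cos_sq θ]
    nlinarith
  exact (pow_le_pow_iff_left₀ h0 (abs_nonneg _) two_ne_zero).mp hsin2

/-- The sine factor on the INNER circle: for `|cos θ| ≤ δ`, `0 < δ ≤ 1/200`,
`|sin{2π(1−δ) sin θ}| ≥ sin(2πδ) > 2π(δ−δ²−δ³) − (2πδ)³/6` (the manuscript's "`= 2πδ(1+o(1))`").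
[cite: Zhang2022LandauSiegel, §4 Lemma 4.6 (proof)] -/
theorem abs_sin_inner_gt {δ θ : ℝ} (hδ0 : 0 < δ) (hδ1 : δ ≤ 1 / 200) (h : |Real.cos θ| ≤ δ) :
    2 * Real.pi * (δ - δ ^ 2 - δ ^ 3) - (2 * Real.pi * δ) ^ 3 / 6
      < |Real.sin (2 * Real.pi * (1 - δ) * Real.sin θ)| := by
  have hπ := Real.pi_pos
  have hπu := Real.pi_lt_d4
  set s : ℝ := |Real.sin θ| with hs
  have hs1 : s ≤ 1 := Real.abs_sin_le_one θ
  have hs0 : 1 - δ ^ 2 ≤ s := one_sub_sq_le_abs_sin h (by linarith)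
  -- reduce to `s = |sin θ|`
  have hodd : |Real.sin (2 * Real.pi * (1 - δ) * Real.sin θ)|
      = |Real.sin (2 * Real.pi * (1 - δ) * s)| := by
    rcases le_or_gt 0 (Real.sin θ) with hpos | hneg
    · rw [hs, abs_of_nonneg hpos]
    · rw [hs, abs_of_neg hneg, show 2 * Real.pi * (1 - δ) * -Real.sin θ
          = -(2 * Real.pi * (1 - δ) * Real.sin θ) by ring, Real.sin_neg, abs_neg]
  rw [hodd]
  -- `2π(1−δ)s = 2π − φ` with `φ = 2π(1 − (1−δ)s) ∈ [2πδ, π/2]`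
  set φ : ℝ := 2 * Real.pi * (1 - (1 - δ) * s) with hφ
  have hrew : 2 * Real.pi * (1 - δ) * s = 2 * Real.pi - φ := by rw [hφ]; ring
  rw [hrew, Real.sin_two_pi_sub, abs_neg]
  have hφlo : 2 * Real.pi * δ ≤ φ := by
    rw [hφ]
    have h1 : δ ≤ 1 - (1 - δ) * s := by nlinarith
    exact mul_le_mul_of_nonneg_left h1 (by positivity)
  have hφhi : φ ≤ Real.pi / 2 := by
    rw [hφ]
    have h1 : (1 - δ) * (1 - δ ^ 2) ≤ (1 - δ) * s :=
      mul_le_mul_of_nonneg_left hs0 (by linarith)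
    have h2 : 3 / 4 ≤ (1 - δ) * (1 - δ ^ 2) := by nlinarith [pow_pos hδ0 3]
    have h3 : 1 - (1 - δ) * s ≤ 1 / 4 := by linarith
    nlinarith
  have hφpos : 0 < φ := lt_of_lt_of_le (by positivity) hφlo
  have hsinφ : 0 < Real.sin φ := Real.sin_pos_of_pos_of_lt_pi hφpos (by linarith)
  rw [abs_of_pos hsinφ]
  -- `sin φ ≥ sin(2πδ) > 2πδ − (2πδ)³/6 ≥ 2π(δ−δ²−δ³) − (2πδ)³/6`
  have hmono : Real.sin (2 * Real.pi * δ) ≤ Real.sin φ :=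
    Real.sin_le_sin_of_le_of_le_pi_div_two (by nlinarith) hφhi hφlo
  have hcube := Real.sin_gt_sub_cube (show 0 < 2 * Real.pi * δ by positivity)
  have hdrop : 2 * Real.pi * (δ - δ ^ 2 - δ ^ 3) ≤ 2 * Real.pi * δ := by
    have : δ - δ ^ 2 - δ ^ 3 ≤ δ := by nlinarith [pow_pos hδ0 3]
    exact mul_le_mul_of_nonneg_left this (by positivity)
  linarith

/-- The sine factor on the OUTER circle (Lemma 4.7's "similar"): for `|cos θ| ≤ δ`, `0 < δ ≤ 1/200`,
`|sin{2π(1+δ) sin θ}| > 2π(δ−δ²−δ³) − (2πδ)³/6`. [cite: Zhang2022LandauSiegel, §4 Lemma 4.7 (proof)] -/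
theorem abs_sin_outer_gt {δ θ : ℝ} (hδ0 : 0 < δ) (hδ1 : δ ≤ 1 / 200) (h : |Real.cos θ| ≤ δ) :
    2 * Real.pi * (δ - δ ^ 2 - δ ^ 3) - (2 * Real.pi * δ) ^ 3 / 6
      < |Real.sin (2 * Real.pi * (1 + δ) * Real.sin θ)| := by
  have hπ := Real.pi_pos
  have hπu := Real.pi_lt_d4
  set s : ℝ := |Real.sin θ| with hs
  have hs1 : s ≤ 1 := Real.abs_sin_le_one θ
  have hs0 : 1 - δ ^ 2 ≤ s := one_sub_sq_le_abs_sin h (by linarith)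
  have hodd : |Real.sin (2 * Real.pi * (1 + δ) * Real.sin θ)|
      = |Real.sin (2 * Real.pi * (1 + δ) * s)| := by
    rcases le_or_gt 0 (Real.sin θ) with hpos | hneg
    · rw [hs, abs_of_nonneg hpos]
    · rw [hs, abs_of_neg hneg, show 2 * Real.pi * (1 + δ) * -Real.sin θ
          = -(2 * Real.pi * (1 + δ) * Real.sin θ) by ring, Real.sin_neg, abs_neg]
  rw [hodd]
  -- `2π(1+δ)s = φ + 2π` with `φ = 2π((1+δ)s − 1) ∈ [2π(δ−δ²−δ³), 2πδ]`
  set φ : ℝ := 2 * Real.pi * ((1 + δ) * s - 1) with hφ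
  have hrew : 2 * Real.pi * (1 + δ) * s = φ + 2 * Real.pi := by rw [hφ]; ring
  rw [hrew, Real.sin_add_two_pi]
  set φ₀ : ℝ := 2 * Real.pi * (δ - δ ^ 2 - δ ^ 3) with hφ₀
  have hdpos : 0 < δ - δ ^ 2 - δ ^ 3 := by nlinarith [pow_pos hδ0 3]
  have hφ₀pos : 0 < φ₀ := by rw [hφ₀]; positivity
  have hφlo : φ₀ ≤ φ := by
    rw [hφ, hφ₀]
    have h1 : (1 + δ) * (1 - δ ^ 2) ≤ (1 + δ) * s :=
      mul_le_mul_of_nonneg_left hs0 (by linarith)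
    have h2 : δ - δ ^ 2 - δ ^ 3 ≤ (1 + δ) * s - 1 := by nlinarith
    exact mul_le_mul_of_nonneg_left h2 (by positivity)
  have hφhi : φ ≤ 2 * Real.pi * δ := by
    rw [hφ]
    have h1 : (1 + δ) * s - 1 ≤ δ := by nlinarith
    exact mul_le_mul_of_nonneg_left h1 (by positivity)
  have hφhi' : φ ≤ Real.pi / 2 := by nlinarith
  have hφpos : 0 < φ := lt_of_lt_of_le hφ₀pos hφlo
  have hsinφ : 0 < Real.sin φ := Real.sin_pos_of_pos_of_lt_pi hφpos (by linarith)
  rw [abs_of_pos hsinφ]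
  have hmono : Real.sin φ₀ ≤ Real.sin φ :=
    Real.sin_le_sin_of_le_of_le_pi_div_two (by linarith) hφhi' hφlo
  have hcube := Real.sin_gt_sub_cube hφ₀pos
  have hφ₀le : φ₀ ≤ 2 * Real.pi * δ := hφlo.trans hφhi
  have hpow : φ₀ ^ 3 ≤ (2 * Real.pi * δ) ^ 3 := pow_le_pow_left₀ hφ₀pos.le hφ₀le 3
  have hφ₀eq : φ₀ = 2 * Real.pi * (δ - δ ^ 2 - δ ^ 3) := hφ₀
  linarith

/-! ### The three case displays, on the inner circle `|w| = α(1−δ)` and on the outer one -/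

/-- **"if `cos θ > c′α𝓛`, then `|P^{−2w}| < 1 − 6c′α𝓛`"** (`w = α(1−δ)(cos θ + i sin θ)`,
`δ = c′α𝓛 ∈ (0, 1/200]`). [cite: Zhang2022LandauSiegel, §4 Lemma 4.6 (proof)] -/
theorem norm_Pw_lt_of_cos_gt {P δ θ : ℝ} (hP : 1 < P) (hδ0 : 0 < δ) (hδ1 : δ ≤ 1 / 200)
    (h : δ < Real.cos θ) :
    ‖Pw P ((alpha P : ℂ) * (((1 - δ : ℝ) : ℂ) * ((Real.cos θ : ℂ) + (Real.sin θ : ℂ) * I)))‖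
      < 1 - 6 * δ := by
  rw [norm_Pw_polar hP]
  have hc : 0 < 2 * Real.pi * (1 - δ) := by
    have : 0 < 1 - δ := by linarith
    positivity
  have h1 : Real.exp (-(2 * Real.pi * (1 - δ) * Real.cos θ))
      < Real.exp (-(2 * Real.pi * (1 - δ) * δ)) := by
    apply Real.exp_lt_exp.mpr
    have := mul_lt_mul_of_pos_left h hc
    linarith
  exact h1.trans (exp_neg_lt_one_sub hδ0 hδ1)

/-- **"if `cos θ < −c′α𝓛`, then `|P^{−2w}| > 1 + 6c′α𝓛`"** (`w = α(1−δ)(cos θ + i sin θ)`,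
`δ = c′α𝓛 ∈ (0, 1/200]`). [cite: Zhang2022LandauSiegel, §4 Lemma 4.6 (proof)] -/
theorem norm_Pw_gt_of_cos_lt {P δ θ : ℝ} (hP : 1 < P) (hδ0 : 0 < δ) (hδ1 : δ ≤ 1 / 200)
    (h : Real.cos θ < -δ) :
    1 + 6 * δ <
      ‖Pw P ((alpha P : ℂ) * (((1 - δ : ℝ) : ℂ) * ((Real.cos θ : ℂ) + (Real.sin θ : ℂ) * I)))‖ := by
  rw [norm_Pw_polar hP]
  have hc : 0 < 2 * Real.pi * (1 - δ) := by
    have : 0 < 1 - δ := by linarith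
    positivity
  have h1 : Real.exp (2 * Real.pi * (1 - δ) * δ)
      < Real.exp (-(2 * Real.pi * (1 - δ) * Real.cos θ)) := by
    apply Real.exp_lt_exp.mpr
    have := mul_lt_mul_of_pos_left h hc
    linarith
  exact (one_add_lt_exp hδ0 hδ1).trans h1

/-- **"if `|cos θ| ≤ c′α𝓛`, then `|Im{P^{−2w}}| > 6c′α𝓛`"** (`w = α(1−δ)(cos θ + i sin θ)`,
`δ = c′α𝓛 ∈ (0, 1/200]`). [cite: Zhang2022LandauSiegel, §4 Lemma 4.6 (proof)] -/
theorem abs_im_Pw_gt_of_abs_cos_le {P δ θ : ℝ} (hP : 1 < P) (hδ0 : 0 < δ) (hδ1 : δ ≤ 1 / 200)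
    (h : |Real.cos θ| ≤ δ) :
    6 * δ <
      |(Pw P ((alpha P : ℂ) * (((1 - δ : ℝ) : ℂ) * ((Real.cos θ : ℂ) + (Real.sin θ : ℂ) * I)))).im| := by
  rw [im_Pw_polar hP, abs_neg, abs_mul, abs_norm, norm_Pw_polar hP]
  have hmod : 1 - 2 * Real.pi * (1 + δ) * δ
      ≤ Real.exp (-(2 * Real.pi * (1 - δ) * Real.cos θ)) := by
    have hcos : Real.cos θ ≤ δ := (le_abs_self _).trans h
    have h1 : (1 - δ) * Real.cos θ ≤ (1 - δ) * δ := mul_le_mul_of_nonneg_left hcos (by linarith)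
    have h2 : (1 - δ) * δ ≤ (1 + δ) * δ := by nlinarith
    have h3 : 2 * Real.pi * ((1 - δ) * Real.cos θ) ≤ 2 * Real.pi * ((1 + δ) * δ) :=
      mul_le_mul_of_nonneg_left (h1.trans h2) (by positivity)
    have h4 : -(2 * Real.pi * (1 + δ) * δ) ≤ -(2 * Real.pi * (1 - δ) * Real.cos θ) := by linarith
    have h5 := Real.add_one_le_exp (-(2 * Real.pi * (1 + δ) * δ))
    have h6 := Real.exp_le_exp.mpr h4
    linarith
  have hsin := abs_sin_inner_gt hδ0 hδ1 h
  have hB := Bδ_pos hδ0 hδ1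
  calc 6 * δ < (1 - 2 * Real.pi * (1 + δ) * δ) *
        (2 * Real.pi * (δ - δ ^ 2 - δ ^ 3) - (2 * Real.pi * δ) ^ 3 / 6) := six_delta_lt hδ0 hδ1
    _ ≤ Real.exp (-(2 * Real.pi * (1 - δ) * Real.cos θ)) *
        (2 * Real.pi * (δ - δ ^ 2 - δ ^ 3) - (2 * Real.pi * δ) ^ 3 / 6) :=
          mul_le_mul_of_nonneg_right hmod hB.le
    _ ≤ Real.exp (-(2 * Real.pi * (1 - δ) * Real.cos θ)) *
        |Real.sin (2 * Real.pi * (1 - δ) * Real.sin θ)| :=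
          mul_le_mul_of_nonneg_left hsin.le (Real.exp_pos _).le

/-- Outer-circle twin of the first case (Lemma 4.7): `cos θ > δ` ⇒ `|P^{−2w}| < 1 − 6δ` for
`w = α(1+δ)(cos θ + i sin θ)`. [cite: Zhang2022LandauSiegel, §4 Lemma 4.7 (proof)] -/
theorem norm_Pw_lt_of_cos_gt_outer {P δ θ : ℝ} (hP : 1 < P) (hδ0 : 0 < δ) (hδ1 : δ ≤ 1 / 200)
    (h : δ < Real.cos θ) :
    ‖Pw P ((alpha P : ℂ) * (((1 + δ : ℝ) : ℂ) * ((Real.cos θ : ℂ) + (Real.sin θ : ℂ) * I)))‖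
      < 1 - 6 * δ := by
  rw [norm_Pw_polar hP]
  have h1 : Real.exp (-(2 * Real.pi * (1 + δ) * Real.cos θ))
      < Real.exp (-(2 * Real.pi * (1 - δ) * δ)) := by
    apply Real.exp_lt_exp.mpr
    have h2 : (1 - δ) * δ ≤ (1 + δ) * δ := by nlinarith
    have h3 : (1 + δ) * δ < (1 + δ) * Real.cos θ := mul_lt_mul_of_pos_left h (by linarith)
    have h4 : 2 * Real.pi * ((1 - δ) * δ) < 2 * Real.pi * ((1 + δ) * Real.cos θ) :=
      mul_lt_mul_of_pos_left (h2.trans_lt h3) (by positivity)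
    linarith
  exact h1.trans (exp_neg_lt_one_sub hδ0 hδ1)

/-- Outer-circle twin of the second case (Lemma 4.7): `cos θ < −δ` ⇒ `|P^{−2w}| > 1 + 6δ` for
`w = α(1+δ)(cos θ + i sin θ)`. [cite: Zhang2022LandauSiegel, §4 Lemma 4.7 (proof)] -/
theorem norm_Pw_gt_of_cos_lt_outer {P δ θ : ℝ} (hP : 1 < P) (hδ0 : 0 < δ) (hδ1 : δ ≤ 1 / 200)
    (h : Real.cos θ < -δ) :
    1 + 6 * δ <
      ‖Pw P ((alpha P : ℂ) * (((1 + δ : ℝ) : ℂ) * ((Real.cos θ : ℂ) + (Real.sin θ : ℂ) * I)))‖ := by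
  rw [norm_Pw_polar hP]
  have h1 : Real.exp (2 * Real.pi * (1 - δ) * δ)
      < Real.exp (-(2 * Real.pi * (1 + δ) * Real.cos θ)) := by
    apply Real.exp_lt_exp.mpr
    have h2 : (1 - δ) * δ ≤ (1 + δ) * δ := by nlinarith
    have h3 : (1 + δ) * Real.cos θ < (1 + δ) * -δ := mul_lt_mul_of_pos_left h (by linarith)
    have h4 : 2 * Real.pi * ((1 + δ) * Real.cos θ) < 2 * Real.pi * ((1 + δ) * -δ) :=
      mul_lt_mul_of_pos_left h3 (by positivity)
    have h5 : 2 * Real.pi * ((1 - δ) * δ) ≤ 2 * Real.pi * ((1 + δ) * δ) :=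
      mul_le_mul_of_nonneg_left h2 (by positivity)
    linarith
  exact (one_add_lt_exp hδ0 hδ1).trans h1

/-- Outer-circle twin of the third case (Lemma 4.7): `|cos θ| ≤ δ` ⇒ `|Im P^{−2w}| > 6δ` for
`w = α(1+δ)(cos θ + i sin θ)`. [cite: Zhang2022LandauSiegel, §4 Lemma 4.7 (proof)] -/
theorem abs_im_Pw_gt_of_abs_cos_le_outer {P δ θ : ℝ} (hP : 1 < P) (hδ0 : 0 < δ)
    (hδ1 : δ ≤ 1 / 200) (h : |Real.cos θ| ≤ δ) :
    6 * δ <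
      |(Pw P ((alpha P : ℂ) * (((1 + δ : ℝ) : ℂ) * ((Real.cos θ : ℂ) + (Real.sin θ : ℂ) * I)))).im| := by
  rw [im_Pw_polar hP, abs_neg, abs_mul, abs_norm, norm_Pw_polar hP]
  have hmod : 1 - 2 * Real.pi * (1 + δ) * δ
      ≤ Real.exp (-(2 * Real.pi * (1 + δ) * Real.cos θ)) := by
    have hcos : Real.cos θ ≤ δ := (le_abs_self _).trans h
    have h1 : (1 + δ) * Real.cos θ ≤ (1 + δ) * δ := mul_le_mul_of_nonneg_left hcos (by linarith)
    have h3 : 2 * Real.pi * ((1 + δ) * Real.cos θ) ≤ 2 * Real.pi * ((1 + δ) * δ) :=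
      mul_le_mul_of_nonneg_left h1 (by positivity)
    have h4 : -(2 * Real.pi * (1 + δ) * δ) ≤ -(2 * Real.pi * (1 + δ) * Real.cos θ) := by linarith
    have h5 := Real.add_one_le_exp (-(2 * Real.pi * (1 + δ) * δ))
    have h6 := Real.exp_le_exp.mpr h4
    linarith
  have hsin := abs_sin_outer_gt hδ0 hδ1 h
  have hB := Bδ_pos hδ0 hδ1
  calc 6 * δ < (1 - 2 * Real.pi * (1 + δ) * δ) *
        (2 * Real.pi * (δ - δ ^ 2 - δ ^ 3) - (2 * Real.pi * δ) ^ 3 / 6) := six_delta_lt hδ0 hδ1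
    _ ≤ Real.exp (-(2 * Real.pi * (1 + δ) * Real.cos θ)) *
        (2 * Real.pi * (δ - δ ^ 2 - δ ^ 3) - (2 * Real.pi * δ) ^ 3 / 6) :=
          mul_le_mul_of_nonneg_right hmod hB.le
    _ ≤ Real.exp (-(2 * Real.pi * (1 + δ) * Real.cos θ)) *
        |Real.sin (2 * Real.pi * (1 + δ) * Real.sin θ)| :=
          mul_le_mul_of_nonneg_left hsin.le (Real.exp_pos _).le

/-! ### (4.13) on the inner circle, and its twin on the outer circle -/

/-- Polar form of a point on the circle `|w| = αr` ("Write `w = α(1−c′α𝓛)(cos θ + i sin θ)`"). [folklore] -/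
private lemma polar_of_norm_eq {P r : ℝ} {w : ℂ} (hw : ‖w‖ = alpha P * r) :
    w = (alpha P : ℂ) * ((r : ℂ) * ((Real.cos (arg w) : ℂ) + (Real.sin (arg w) : ℂ) * I)) := by
  have h := Complex.norm_mul_exp_arg_mul_I w
  rw [hw] at h
  rw [Complex.ofReal_cos, Complex.ofReal_sin, ← Complex.exp_mul_I]
  calc w = ((alpha P * r : ℝ) : ℂ) * Complex.exp ((arg w : ℂ) * I) := h.symm
    _ = (alpha P : ℂ) * ((r : ℂ) * Complex.exp ((arg w : ℂ) * I)) := by push_cast; ring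

/-- From the three cases: `|1 − z| > 6δ` whenever `|z| < 1 − 6δ`, or `|z| > 1 + 6δ`, or
`|Im z| > 6δ`. [folklore] -/
private lemma norm_one_sub_gt_of_cases {z : ℂ} {δ : ℝ}
    (h : ‖z‖ < 1 - 6 * δ ∨ 1 + 6 * δ < ‖z‖ ∨ 6 * δ < |z.im|) : 6 * δ < ‖1 - z‖ := by
  rcases h with h | h | h
  · have := norm_sub_norm_le (1 : ℂ) z
    rw [norm_one] at this
    linarith
  · have := norm_sub_norm_le z (1 : ℂ)
    rw [norm_one, norm_sub_rev] at this
    linarith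
  · have := Complex.abs_im_le_norm (1 - z)
    rw [Complex.sub_im, Complex.one_im, zero_sub, abs_neg] at this
    linarith

/-- **(4.13)**: `|1 − P^{−2w}| > 6c′α𝓛` for `|w| = α(1 − c′α𝓛)`, with `δ = c′α𝓛 ∈ (0, 1/200]` in place
of "`D` sufficiently large". [cite: Zhang2022LandauSiegel, §4 Lemma 4.6 (proof), (4.13)] -/
theorem ineq413 {P δ : ℝ} (hP : 1 < P) (hδ0 : 0 < δ) (hδ1 : δ ≤ 1 / 200) {w : ℂ}
    (hw : ‖w‖ = alpha P * (1 - δ)) : 6 * δ < ‖1 - Pw P w‖ := by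
  have hpol := polar_of_norm_eq (r := 1 - δ) hw
  set θ := arg w
  apply norm_one_sub_gt_of_cases
  rw [hpol]
  rcases lt_or_ge δ (Real.cos θ) with h1 | h1
  · exact Or.inl (norm_Pw_lt_of_cos_gt hP hδ0 hδ1 h1)
  rcases lt_or_ge (Real.cos θ) (-δ) with h2 | h2
  · exact Or.inr (Or.inl (norm_Pw_gt_of_cos_lt hP hδ0 hδ1 h2))
  · exact Or.inr (Or.inr (abs_im_Pw_gt_of_abs_cos_le hP hδ0 hδ1 (abs_le.mpr ⟨h2, h1⟩)))

/-- **Lemma 4.7's twin of (4.13)** ("in a way similar to the proof of Lemma 4.6, it is direct to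
verify"): `|1 − P^{−2w}| > 6δ` also on the OUTER circle `|w| = α(1 + δ)`, `0 < δ ≤ 1/200`.
[cite: Zhang2022LandauSiegel, §4 Lemma 4.7 (proof)] -/
theorem ineq413_outer {P δ : ℝ} (hP : 1 < P) (hδ0 : 0 < δ) (hδ1 : δ ≤ 1 / 200) {w : ℂ}
    (hw : ‖w‖ = alpha P * (1 + δ)) : 6 * δ < ‖1 - Pw P w‖ := by
  have hpol := polar_of_norm_eq (r := 1 + δ) hw
  set θ := arg w
  apply norm_one_sub_gt_of_cases
  rw [hpol]
  rcases lt_or_ge δ (Real.cos θ) with h1 | h1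
  · exact Or.inl (norm_Pw_lt_of_cos_gt_outer hP hδ0 hδ1 h1)
  rcases lt_or_ge (Real.cos θ) (-δ) with h2 | h2
  · exact Or.inr (Or.inl (norm_Pw_gt_of_cos_lt_outer hP hδ0 hδ1 h2))
  · exact Or.inr (Or.inr (abs_im_Pw_gt_of_abs_cos_le_outer hP hδ0 hδ1 (abs_le.mpr ⟨h2, h1⟩)))

/-- On both circles `1 − P^{−2w}` has no zero (so Rouché's hypothesis `|f − g| < |g|` is meaningful
there). [cite: Zhang2022LandauSiegel, §4 Lemma 4.6 (proof), (4.13)] -/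
theorem one_sub_Pw_ne_zero_of_norm_eq {P δ : ℝ} (hP : 1 < P) (hδ0 : 0 < δ) (hδ1 : δ ≤ 1 / 200)
    {w : ℂ} (hw : ‖w‖ = alpha P * (1 - δ) ∨ ‖w‖ = alpha P * (1 + δ)) : 1 - Pw P w ≠ 0 := by
  intro h0
  rcases hw with hw | hw
  · have := ineq413 hP hδ0 hδ1 hw
    rw [h0, norm_zero] at this
    linarith
  · have := ineq413_outer hP hδ0 hδ1 hw
    rw [h0, norm_zero] at this
    linarith

/-! ### The zeros of `1 − P^{−2w}`: `w = ikα`, all simple -/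

/-- The zeros of `1 − P^{−2w}` are exactly the points `ikα`, `k ∈ ℤ` (`P > 1`).
[cite: Zhang2022LandauSiegel, §4 Lemma 4.6 (proof)] -/
theorem Pw_eq_one_iff {P : ℝ} (hP : 1 < P) (w : ℂ) :
    Pw P w = 1 ↔ ∃ k : ℤ, w = (k : ℂ) * (I * (alpha P : ℂ)) := by
  have hα0 : (alpha P : ℂ) ≠ 0 := Complex.ofReal_ne_zero.mpr (alpha_pos hP).ne'
  have h2π : (2 * (Real.pi : ℂ)) ≠ 0 :=
    mul_ne_zero two_ne_zero (Complex.ofReal_ne_zero.mpr Real.pi_pos.ne')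
  constructor
  · intro h
    -- write `w = α u`
    set u : ℂ := w / (alpha P : ℂ) with hu
    have hwu : w = (alpha P : ℂ) * u := by
      rw [hu, mul_div_assoc', mul_div_cancel_left₀ w hα0]
    rw [hwu, Pw_alpha_mul hP, Complex.exp_eq_one_iff] at h
    obtain ⟨n, hn⟩ := h
    refine ⟨-n, ?_⟩
    have hu' : (2 * (Real.pi : ℂ)) * u = (2 * (Real.pi : ℂ)) * (-((n : ℂ) * I)) := by
      linear_combination -hn
    have hu'' : u = -((n : ℂ) * I) := mul_left_cancel₀ h2π hu'
    rw [hwu, hu'']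
    push_cast
    ring
  · rintro ⟨k, hk⟩
    rw [hk, show (k : ℂ) * (I * (alpha P : ℂ)) = (alpha P : ℂ) * ((k : ℂ) * I) by ring,
      Pw_alpha_mul hP, Complex.exp_eq_one_iff]
    exact ⟨-k, by push_cast; ring⟩

/-- Norm of the lattice point `ikα`. [folklore] -/
private lemma norm_int_mul_I_alpha {P : ℝ} (hP : 1 < P) (k : ℤ) :
    ‖(k : ℂ) * (I * (alpha P : ℂ))‖ = |(k : ℝ)| * alpha P := by
  rw [norm_mul, norm_mul, Complex.norm_I, one_mul, Complex.norm_real, Complex.norm_intCast,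
    Real.norm_eq_abs, abs_of_pos (alpha_pos hP)]

/-- **"the function `1 − P^{−2w}` has exactly one zero inside this circle which is at `w = 0`"**:
inside `|w| < α(1−δ)` (`0 ≤ δ < 1`) the zero set of `1 − P^{−2w}` is `{0}`.
[cite: Zhang2022LandauSiegel, §4 Lemma 4.6 (proof)] -/
theorem zeros_inner_disc {P δ : ℝ} (hP : 1 < P) (hδ0 : 0 ≤ δ) (hδ1 : δ < 1) :
    {w : ℂ | ‖w‖ < alpha P * (1 - δ) ∧ Pw P w = 1} = {0} := by
  have hα := alpha_pos hP
  ext w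
  simp only [Set.mem_setOf_eq, Set.mem_singleton_iff]
  constructor
  · rintro ⟨hw, h1⟩
    obtain ⟨k, rfl⟩ := (Pw_eq_one_iff hP _).mp h1
    rw [norm_int_mul_I_alpha hP] at hw
    have hk : |(k : ℝ)| < 1 := by
      by_contra hcon
      push Not at hcon
      have := mul_le_mul_of_nonneg_right hcon hα.le
      nlinarith
    rw [← Int.cast_abs] at hk
    have hk' : |k| < 1 := by exact_mod_cast hk
    obtain ⟨hk1, hk2⟩ := abs_lt.mp hk'
    have hk0 : k = 0 := by omega
    simp [hk0]
  · rintro rfl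
    refine ⟨?_, (Pw_eq_one_iff hP 0).mpr ⟨0, by simp⟩⟩
    rw [norm_zero]
    exact mul_pos hα (by linarith)

/-- **"the later has exactly three zeros inside the same circle which are at `w = 0`, `w = iα` and
`w = −iα`"**: inside `|w| < α(1+δ)` (`0 < δ ≤ 1`) the zero set of `1 − P^{−2w}` is `{0, iα, −iα}`.
[cite: Zhang2022LandauSiegel, §4 Lemma 4.7 (proof)] -/
theorem zeros_outer_disc {P δ : ℝ} (hP : 1 < P) (hδ0 : 0 < δ) (hδ1 : δ ≤ 1) :
    {w : ℂ | ‖w‖ < alpha P * (1 + δ) ∧ Pw P w = 1}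
      = {0, I * (alpha P : ℂ), -(I * (alpha P : ℂ))} := by
  have hα := alpha_pos hP
  ext w
  simp only [Set.mem_setOf_eq, Set.mem_insert_iff, Set.mem_singleton_iff]
  constructor
  · rintro ⟨hw, h1⟩
    obtain ⟨k, rfl⟩ := (Pw_eq_one_iff hP _).mp h1
    rw [norm_int_mul_I_alpha hP] at hw
    have hk : |(k : ℝ)| < 2 := by
      by_contra hcon
      push Not at hcon
      have := mul_le_mul_of_nonneg_right hcon hα.le
      nlinarith
    rw [← Int.cast_abs] at hk
    have hk' : |k| < 2 := by exact_mod_cast hk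
    obtain ⟨hk1, hk2⟩ := abs_lt.mp hk'
    have hk3 : k = 0 ∨ k = 1 ∨ k = -1 := by omega
    rcases hk3 with rfl | rfl | rfl
    · left; simp
    · right; left; simp
    · right; right; simp
  · rintro (rfl | rfl | rfl)
    · refine ⟨?_, (Pw_eq_one_iff hP 0).mpr ⟨0, by simp⟩⟩
      rw [norm_zero]; positivity
    · refine ⟨?_, (Pw_eq_one_iff hP _).mpr ⟨1, by simp⟩⟩
      rw [norm_mul, Complex.norm_I, one_mul, Complex.norm_real, Real.norm_eq_abs, abs_of_pos hα]
      nlinarith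
    · refine ⟨?_, (Pw_eq_one_iff hP _).mpr ⟨-1, by simp⟩⟩
      rw [norm_neg, norm_mul, Complex.norm_I, one_mul, Complex.norm_real, Real.norm_eq_abs,
        abs_of_pos hα]
      nlinarith

/-- The derivative of the comparison function: `d/dw (1 − P^{−2w}) = 2(log P)·P^{−2w}`.
[cite: Zhang2022LandauSiegel, §4 Lemma 4.6 (proof)] -/
theorem hasDerivAt_one_sub_Pw (P : ℝ) (w : ℂ) :
    HasDerivAt (fun w => 1 - Pw P w) (2 * (Real.log P : ℂ) * Pw P w) w := by
  have h := (hasDerivAt_Pw P w).const_sub 1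
  have e : -(-(2 * (Real.log P : ℂ)) * Pw P w) = 2 * (Real.log P : ℂ) * Pw P w := by ring
  rw [e] at h
  exact h

/-- **"counted with multiplicity"**: every zero of `1 − P^{−2w}` is simple — the derivative
`2(log P)P^{−2w}` never vanishes (`P > 1`); so the counts in Lemmas 4.6 / 4.7 are `1` and `3`.
[cite: Zhang2022LandauSiegel, §4 Lemma 4.6 (proof)] -/
theorem deriv_one_sub_Pw_ne_zero {P : ℝ} (hP : 1 < P) (w : ℂ) :
    deriv (fun w => 1 - Pw P w) w ≠ 0 := by
  rw [(hasDerivAt_one_sub_Pw P w).deriv]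
  have hlog : (Real.log P : ℂ) ≠ 0 := Complex.ofReal_ne_zero.mpr (Real.log_pos hP).ne'
  exact mul_ne_zero (mul_ne_zero two_ne_zero hlog) (Pw_ne_zero P w)

/-! ### Sharpness: the constant in (4.13) is `< 2π` -/

/-- At the top of the inner circle, `w = iα(1−δ)`: `|1 − P^{−2w}| = |1 − e^{2πiδ}| = 2|sin(πδ)|`
EXACT. [cite: Zhang2022LandauSiegel, §4 Lemma 4.6 (proof), (4.13)] -/
theorem norm_one_sub_Pw_I_mul {P : ℝ} (hP : 1 < P) (δ : ℝ) :
    ‖1 - Pw P (I * (alpha P : ℂ) * ((1 - δ : ℝ) : ℂ))‖ = 2 * |Real.sin (Real.pi * δ)| := by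
  have hrew : I * (alpha P : ℂ) * ((1 - δ : ℝ) : ℂ) = (alpha P : ℂ) * (I * ((1 - δ : ℝ) : ℂ)) := by
    ring
  rw [hrew, Pw_alpha_mul hP]
  have hper : Complex.exp (-(2 * Real.pi * (I * ((1 - δ : ℝ) : ℂ))))
      = Complex.exp (I * ((2 * Real.pi * δ : ℝ) : ℂ)) := by
    rw [Complex.exp_eq_exp_iff_exists_int]
    refine ⟨-1, ?_⟩
    push_cast
    ring
  rw [hper, norm_sub_rev, Complex.norm_exp_I_mul_ofReal_sub_one, Real.norm_eq_abs, abs_mul,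
    abs_two, show 2 * Real.pi * δ / 2 = Real.pi * δ by ring]

/-- **The constant `6` of (4.13) cannot be replaced by anything `≥ 2π`** (the cell's design row
I-4.13a "`c_R < 2π`", as a theorem): if for some `δ ∈ (0, 1]` the bound `|1 − P^{−2w}| > cδ` holds on
the whole circle `|w| = α(1−δ)`, then `c < 2π` — test it at `w = iα(1−δ)`, where
`|1 − P^{−2w}| = 2 sin(πδ) < 2πδ`. [cite: Zhang2022LandauSiegel, §4 Lemma 4.6 (proof), (4.13)] -/
theorem lt_two_pi_of_ineq413 {P δ c : ℝ} (hP : 1 < P) (hδ0 : 0 < δ) (hδ1 : δ ≤ 1)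
    (h : ∀ w : ℂ, ‖w‖ = alpha P * (1 - δ) → c * δ < ‖1 - Pw P w‖) : c < 2 * Real.pi := by
  have hα := alpha_pos hP
  have hw : ‖I * (alpha P : ℂ) * ((1 - δ : ℝ) : ℂ)‖ = alpha P * (1 - δ) := by
    rw [norm_mul, norm_mul, Complex.norm_I, one_mul, Complex.norm_real, Complex.norm_real,
      Real.norm_eq_abs, Real.norm_eq_abs, abs_of_pos hα, abs_of_nonneg (by linarith)]
  have h1 := h _ hw
  rw [norm_one_sub_Pw_I_mul hP] at h1
  have hsin0 : 0 ≤ Real.sin (Real.pi * δ) :=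
    Real.sin_nonneg_of_nonneg_of_le_pi (by positivity) (by nlinarith [Real.pi_pos])
  rw [abs_of_nonneg hsin0] at h1
  have hlt : Real.sin (Real.pi * δ) < Real.pi * δ := Real.sin_lt (by positivity)
  nlinarith

/-- The printed constant passes the test: `6 < 2π`. [cite: Zhang2022LandauSiegel, §4 (4.13)] -/
theorem six_lt_two_pi : (6 : ℝ) < 2 * Real.pi := by
  have := Real.pi_gt_d2
  linarith

end Lemma46

end Literature.NumberTheory.LFunctions.Zhang2022
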